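import Summits.RiemannHypothesis.RiemannHypothesis.Theorems.WeilWindowFlowWindowLipschitzStubLocalizedCutAux2
import HarnessLib

/-!
# Edge values: the left lag-derivative of the increment at the support diameter — RH-free helper

pub-rhpf (mechanism / rigidity campaign; **no RH claims**), theory-1 gen 5, THEORY-EDGE-5 §2.4.

For `f ∈ L²(ℝ)` vanishing on `|x| ≥ a` (`a > 0`) whose restriction to `(-a, a)` agrees with a
function `g` continuous on `[-a, a]` (so `g(±a)` are the EDGE VALUES of `f` from inside), the
increment `t ↦ D_t(f) = ∫ |f(x+t) − f(x)|² dx` has the LEFT derivative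

  `D'(2a⁻) = 2 · Re (g(a) · conj g(−a))`

at the support diameter `t = 2a` (`hasDerivWithinAt_weilIncrement_diam`).  Ingredients [folklore]:
the autocorrelation form `D_t(f) = 2‖f‖² − 2 Re ∫ f(x+t) conj f(x) dx` for `L²` functions
(`weilIncrement_eq_two_mul_sub_cross`), localisation of the cross term to the overlap interval
`(-a, a − t)` of length `2a − t` (`integral_cross_eq_intervalIntegral`), and continuity of `g` at
the two edges (`tendsto_avg_cross`: the average of `Re g(x+t) conj g(x)` over the overlap tends to
`Re g(a) conj g(−a)` as `t ↑ 2a`).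

Use (with `Theorems/PfPersistenceEdgeLawCorner`): this is the hypothesis `hD` of
`WindowForm.corner_of_entering_lag` / `corner_gap` with `D' = 2 Re(g(a) conj g(−a))`; for a real
even state with edge value `θ = g(a) = g(−a)` the corner gap at the entering window `a = ½ log n₀`
of a table with weight `c = w(n₀)` is `≥ 2c·D' = 4 w(n₀) θ²` — the campaign's Galerkin kink law
(PF.md §14.2; DATA THEORY-2.md §3), now at schema level.  No arithmetic is read here.  No RH content.

References: folklore real analysis (autocorrelation of `L²` functions; continuity of averages).
-/

set_option linter.dupNamespace false

noncomputable section

open MeasureTheory Set Filter intervalIntegral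
open scoped Topology ComplexConjugate Interval

namespace Summit.RiemannHypothesis.RiemannHypothesis.Theorems.PfPersistence

open Literature.NumberTheory.LFunctions
open Summit.RiemannHypothesis.RiemannHypothesis.Theorems.WeilWindowFlowWindowLipschitz

/-! ## §1 The autocorrelation form of the increment -/

/-- `D_t(f) = 2‖f‖² − 2 ∫ Re (f(x+t) conj f(x)) dx` for `f ∈ L²` (polarisation of
`|p − q|² = |p|² + |q|² − 2 Re p q̄`, translation invariance of `∫ |f(x+t)|²`). [folklore] -/
theorem weilIncrement_eq_two_mul_sub_cross {f : ℝ → ℂ} (hf : MemLp f 2) (t : ℝ) :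
    weilIncrement f t = 2 * (∫ x, ‖f x‖ ^ 2) - 2 * ∫ x, (f (x + t) * conj (f x)).re := by
  have hft : MemLp (fun x ↦ f (x + t)) 2 :=
    hf.comp_measurePreserving (measurePreserving_add_right volume t)
  have hi2 : Integrable (fun x ↦ ‖f x‖ ^ 2) := (memLp_two_iff_integrable_sq_norm hf.1).1 hf
  have hi2t : Integrable (fun x ↦ ‖f (x + t)‖ ^ 2) := hi2.comp_add_right t
  have hS : Integrable (fun x ↦ ‖f (x + t) - f x‖ ^ 2) :=
    (memLp_two_iff_integrable_sq_norm (hft.sub hf).1).1 (hft.sub hf)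
  have hpt : ∀ x, 2 * (f (x + t) * conj (f x)).re =
      ‖f (x + t)‖ ^ 2 + ‖f x‖ ^ 2 - ‖f (x + t) - f x‖ ^ 2 := by
    intro x
    rw [Complex.sq_norm, Complex.sq_norm, Complex.sq_norm, Complex.normSq_sub]
    ring
  have hAB : Integrable (fun x ↦ ‖f (x + t)‖ ^ 2 + ‖f x‖ ^ 2) := hi2t.add hi2
  have e1 : ∫ x, 2 * (f (x + t) * conj (f x)).re =
      ((∫ x, ‖f (x + t)‖ ^ 2) + ∫ x, ‖f x‖ ^ 2) - ∫ x, ‖f (x + t) - f x‖ ^ 2 := by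
    have h1 : ∫ x, 2 * (f (x + t) * conj (f x)).re =
        ∫ x, ((‖f (x + t)‖ ^ 2 + ‖f x‖ ^ 2) - ‖f (x + t) - f x‖ ^ 2) :=
      integral_congr_ae (ae_of_all _ fun x ↦ hpt x)
    rw [h1, integral_sub hAB hS, integral_add hi2t hi2]
  rw [integral_add_right_eq_self (fun x ↦ ‖f x‖ ^ 2) t, MeasureTheory.integral_const_mul] at e1
  unfold weilIncrement
  linarith

/-! ## §2 Localisation of the cross term to the overlap interval -/

/-- For `f` vanishing on `|x| ≥ a` and agreeing with `g` on `(-a, a)`, and `0 ≤ t ≤ 2a`: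
`∫ Re f(x+t) conj f(x) dx = ∫_{-a}^{a-t} Re g(x+t) conj g(x) dx`. [folklore] -/
theorem integral_cross_eq_intervalIntegral {f g : ℝ → ℂ} {a t : ℝ}
    (hfs : ∀ x, a ≤ |x| → f x = 0) (hfg : ∀ x ∈ Ioo (-a) a, f x = g x) (ht0 : 0 ≤ t)
    (ht : t ≤ 2 * a) :
    ∫ x, (f (x + t) * conj (f x)).re = ∫ x in (-a)..(a - t), (g (x + t) * conj (g x)).re := by
  have hzero : ∀ x, x ∉ Ioo (-a) (a - t) → (f (x + t) * conj (f x)).re = 0 := by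
    intro x hx
    simp only [mem_Ioo, not_and_or, not_lt] at hx
    rcases hx with hx | hx
    · have hxa : a ≤ |x| := by
        rw [abs_of_nonpos (by linarith)]
        linarith
      simp [hfs x hxa]
    · have hxa : a ≤ |x + t| := le_trans (by linarith) (le_abs_self _)
      simp [hfs (x + t) hxa]
  rw [← setIntegral_eq_integral_of_forall_compl_eq_zero hzero,
    intervalIntegral.integral_of_le (by linarith : -a ≤ a - t), integral_Ioc_eq_integral_Ioo]
  refine setIntegral_congr_fun measurableSet_Ioo fun x hx ↦ ?_
  have hx1 : x ∈ Ioo (-a) a := ⟨hx.1, by linarith [hx.2]⟩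
  have hx2 : x + t ∈ Ioo (-a) a := ⟨by linarith [hx.1], by linarith [hx.2]⟩
  simp only [hfg x hx1, hfg (x + t) hx2]

/-! ## §3 Continuity at the edges: the overlap average tends to `Re g(a) conj g(−a)` -/

/-- Elementary product estimate: `|Re(p q̄) − Re(P Q̄)| ≤ ‖p − P‖‖q‖ + ‖P‖‖q − Q‖`. [folklore] -/
theorem abs_re_mul_conj_sub_le (p q P Q : ℂ) :
    |(p * conj q).re - (P * conj Q).re| ≤ ‖p - P‖ * ‖q‖ + ‖P‖ * ‖q - Q‖ := by
  have e : (p * conj q).re - (P * conj Q).re = ((p - P) * conj q + P * conj (q - Q)).re := by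
    simp only [map_sub, Complex.sub_re, Complex.add_re, sub_mul, mul_sub]
    ring
  rw [e]
  refine (Complex.abs_re_le_norm _).trans ?_
  refine (norm_add_le _ _).trans ?_
  rw [norm_mul, norm_mul, Complex.norm_conj, Complex.norm_conj]

/-- The overlap integrand is continuous on the overlap interval (for `0 ≤ t`). [folklore] -/
theorem continuousOn_cross {g : ℝ → ℂ} {a t : ℝ} (hg : ContinuousOn g (Icc (-a) a))
    (ht0 : 0 ≤ t) :
    ContinuousOn (fun x ↦ (g (x + t) * conj (g x)).re) (Icc (-a) (a - t)) := by
  have h1 : ContinuousOn (fun x ↦ g (x + t)) (Icc (-a) (a - t)) := by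
    refine hg.comp (continuous_id.add continuous_const).continuousOn fun x hx ↦ ?_
    exact ⟨by linarith [hx.1], by linarith [hx.2]⟩
  have h2 : ContinuousOn g (Icc (-a) (a - t)) := hg.mono (Icc_subset_Icc le_rfl (by linarith))
  exact Complex.continuous_re.comp_continuousOn
    (h1.mul (Complex.continuous_conj.comp_continuousOn h2))

/-- **Continuity at the edges.** For `g` continuous on `[-a, a]` (`a > 0`), the average of
`Re g(x+t) conj g(x)` over the overlap interval `[-a, a-t]` tends to `Re g(a) conj g(−a)` as
`t ↑ 2a`. [folklore] -/
theorem tendsto_avg_cross {g : ℝ → ℂ} {a : ℝ} (ha : 0 < a) (hg : ContinuousOn g (Icc (-a) a)) :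
    Tendsto (fun t ↦ (2 * a - t)⁻¹ * ∫ x in (-a)..(a - t), (g (x + t) * conj (g x)).re)
      (𝓝[<] (2 * a)) (𝓝 ((g a * conj (g (-a))).re)) := by
  set L : ℝ := (g a * conj (g (-a))).re with hL
  rw [Metric.tendsto_nhdsWithin_nhds]
  intro ε hε
  -- tolerance for the edge values
  set K : ℝ := ‖g a‖ + ‖g (-a)‖ + 1 with hK
  have hK0 : 0 < K := by positivity
  set ε₁ : ℝ := min 1 (ε / (2 * K)) with hε₁
  have hε₁0 : 0 < ε₁ := lt_min one_pos (by positivity)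
  have hε₁1 : ε₁ ≤ 1 := min_le_left _ _
  have hε₁K : ε₁ * K ≤ ε / 2 := by
    have h := min_le_right 1 (ε / (2 * K))
    rw [← hε₁] at h
    calc ε₁ * K ≤ ε / (2 * K) * K := mul_le_mul_of_nonneg_right h hK0.le
      _ = ε / 2 := by field_simp
  -- continuity of g within [-a, a] at the two edges
  have hca : ContinuousWithinAt g (Icc (-a) a) a := hg a ⟨by linarith, le_rfl⟩
  have hcb : ContinuousWithinAt g (Icc (-a) a) (-a) := hg (-a) ⟨le_rfl, by linarith⟩
  rw [Metric.continuousWithinAt_iff] at hca hcb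
  obtain ⟨δ₁, hδ₁, h₁⟩ := hca ε₁ hε₁0
  obtain ⟨δ₂, hδ₂, h₂⟩ := hcb ε₁ hε₁0
  refine ⟨min (min δ₁ δ₂) a, lt_min (lt_min hδ₁ hδ₂) ha, fun t ht hdist ↦ ?_⟩
  have htlt : t < 2 * a := ht
  rw [Real.dist_eq, abs_sub_comm, abs_of_pos (by linarith)] at hdist
  have hd1 : 2 * a - t < δ₁ := lt_of_lt_of_le hdist ((min_le_left _ _).trans (min_le_left _ _))
  have hd2 : 2 * a - t < δ₂ := lt_of_lt_of_le hdist ((min_le_left _ _).trans (min_le_right _ _))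
  have hda : 2 * a - t < a := lt_of_lt_of_le hdist (min_le_right _ _)
  have ht0 : 0 ≤ t := by linarith
  have hs0 : 0 < 2 * a - t := by linarith
  have hle : -a ≤ a - t := by linarith
  -- pointwise bound on the overlap interval
  have hpt : ∀ x ∈ Ι (-a) (a - t), ‖(g (x + t) * conj (g x)).re - L‖ ≤ ε / 2 := by
    intro x hx
    rw [uIoc_of_le hle] at hx
    have hxI : x ∈ Icc (-a) a := ⟨hx.1.le, by linarith [hx.2]⟩
    have hxtI : x + t ∈ Icc (-a) a := ⟨by linarith [hx.1], by linarith [hx.2]⟩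
    have hgx : ‖g x - g (-a)‖ < ε₁ := by
      have h := h₂ hxI (by rw [Real.dist_eq, abs_of_nonneg (by linarith [hx.1])]; linarith [hx.2])
      rwa [dist_eq_norm] at h
    have hgxt : ‖g (x + t) - g a‖ < ε₁ := by
      have h := h₁ hxtI (by
        rw [Real.dist_eq, abs_of_nonpos (by linarith [hx.2])]
        linarith [hx.1])
      rwa [dist_eq_norm] at h
    have hq : ‖g x‖ ≤ ‖g (-a)‖ + ε₁ := by
      linarith [norm_le_norm_add_norm_sub' (g x) (g (-a))]
    rw [Real.norm_eq_abs, hL]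
    calc |(g (x + t) * conj (g x)).re - (g a * conj (g (-a))).re|
        ≤ ‖g (x + t) - g a‖ * ‖g x‖ + ‖g a‖ * ‖g x - g (-a)‖ := abs_re_mul_conj_sub_le _ _ _ _
      _ ≤ ε₁ * (‖g (-a)‖ + ε₁) + ‖g a‖ * ε₁ := by
          gcongr
      _ ≤ ε₁ * K := by
          rw [hK]
          nlinarith [norm_nonneg (g a), norm_nonneg (g (-a))]
      _ ≤ ε / 2 := hε₁K
  -- integrate the bound
  have hint : IntervalIntegrable (fun x ↦ (g (x + t) * conj (g x)).re) volume (-a) (a - t) := by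
    refine ContinuousOn.intervalIntegrable ?_
    rw [uIcc_of_le hle]
    exact continuousOn_cross hg ht0
  have hI : ‖(∫ x in (-a)..(a - t), (g (x + t) * conj (g x)).re) - (2 * a - t) * L‖ ≤
      ε / 2 * (2 * a - t) := by
    have e : (∫ x in (-a)..(a - t), (g (x + t) * conj (g x)).re) - (2 * a - t) * L =
        ∫ x in (-a)..(a - t), ((g (x + t) * conj (g x)).re - L) := by
      rw [intervalIntegral.integral_sub hint intervalIntegrable_const, intervalIntegral.integral_const]
      simp only [smul_eq_mul]
      ring
    rw [e]
    have h := intervalIntegral.norm_integral_le_of_norm_le_const hpt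
    calc ‖∫ x in (-a)..(a - t), ((g (x + t) * conj (g x)).re - L)‖
        ≤ ε / 2 * |a - t - -a| := h
      _ = ε / 2 * (2 * a - t) := by rw [show a - t - -a = 2 * a - t by ring, abs_of_pos hs0]
  rw [Real.dist_eq]
  have e2 : (2 * a - t)⁻¹ * (∫ x in (-a)..(a - t), (g (x + t) * conj (g x)).re) - L =
      (2 * a - t)⁻¹ * ((∫ x in (-a)..(a - t), (g (x + t) * conj (g x)).re) - (2 * a - t) * L) := by
    field_simp
  rw [e2, abs_mul, abs_inv, abs_of_pos hs0]
  rw [Real.norm_eq_abs] at hI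
  calc (2 * a - t)⁻¹ * |(∫ x in (-a)..(a - t), (g (x + t) * conj (g x)).re) - (2 * a - t) * L|
      ≤ (2 * a - t)⁻¹ * (ε / 2 * (2 * a - t)) := by gcongr
    _ = ε / 2 := by field_simp
    _ < ε := by linarith

/-! ## §4 The left lag-derivative of the increment at the diameter -/

/-- **EDGE VALUES GIVE THE KINK OF THE INCREMENT.** For `f ∈ L²` vanishing on `|x| ≥ a` (`a > 0`)
and agreeing on `(-a, a)` with `g` continuous on `[-a, a]`:
`t ↦ D_t(f)` has left derivative `2 Re(g(a) conj g(−a))` at `t = 2a` (while `D_t(f) = 2‖f‖²` is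
constant for `t ≥ 2a`). [folklore] -/
theorem hasDerivWithinAt_weilIncrement_diam {f g : ℝ → ℂ} {a : ℝ} (ha : 0 < a) (hf : MemLp f 2)
    (hfs : ∀ x, a ≤ |x| → f x = 0) (hfg : ∀ x ∈ Ioo (-a) a, f x = g x)
    (hg : ContinuousOn g (Icc (-a) a)) :
    HasDerivWithinAt (weilIncrement f) (2 * (g a * conj (g (-a))).re) (Iio (2 * a)) (2 * a) := by
  rw [hasDerivWithinAt_iff_tendsto_slope' (by simp : (2 * a) ∉ Iio (2 * a))]
  have h2a : weilIncrement f (2 * a) = 2 * ∫ x, ‖f x‖ ^ 2 :=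
    stub_localizedCut_weilIncrement_eq_two_mul hf hfs le_rfl
  have key : ∀ᶠ t in 𝓝[<] (2 * a), 2 * ((2 * a - t)⁻¹ *
      ∫ x in (-a)..(a - t), (g (x + t) * conj (g x)).re) = slope (weilIncrement f) (2 * a) t := by
    filter_upwards [Ioo_mem_nhdsLT (by positivity : (0 : ℝ) < 2 * a)] with t ht
    rw [slope_def_field, h2a, weilIncrement_eq_two_mul_sub_cross hf t,
      integral_cross_eq_intervalIntegral hfs hfg ht.1.le ht.2.le]
    have hne : t - 2 * a ≠ 0 := by linarith [ht.2]
    have hne' : 2 * a - t ≠ 0 := by linarith [ht.2]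
    field_simp
    ring
  refine Tendsto.congr' key ?_
  have h := (tendsto_avg_cross ha hg).const_mul 2
  exact h

end Summit.RiemannHypothesis.RiemannHypothesis.Theorems.PfPersistence

end
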